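import Summits.CriticalPhenomena.CardyFormulaZ2.Theses.CardyUSTContinuation

/-!
# Route CardyUSTContinuation — assembly item `Assembly`

Closes item stmt-CriticalPhenomena-6054 of route CardyUSTContinuation:
`SmallFugacityLimit → UniformAnalyticExtension → BernoulliEndpoint → ContinuumFamily →
VitaliContinuation → CardyFormulaZ2`.

Proof (pure plumbing, as in the route's assembly paragraph). Fix a conformal rectangle `R` and a
uniformizing datum `(φ, x)`, `η = crossRatio x ∈ (0,1)`. `SmallFugacityLimit` gives `t₀ > 0` with
`u_R(t, δ) → U(t, η)` for every `t ∈ (0, t₀)`. If `t₀ > 1` take `t = 1` directly. Otherwise put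
`t₁ := t₀ / 2`; `UniformAnalyticExtension` at `(R, t₁)` gives `ρ, M` and, eventually in `δ`,
analytic extensions `g_δ` of `u_R(·, δ)|[t₁, 1]` to the `ρ`-neighbourhood of `[t₁, 1] ⊆ ℂ`
(one is chosen by `Classical.epsilon`); `ContinuumFamily (ii)` gives an analytic extension `Uc`
of `U(·, η)` near `[0, 1]`; both radii are shrunk to their minimum. On `(t₁, t₀)`,
`g_δ(t) = u_R(t, δ) → U(t, η) = Uc(t)`, so `VitaliContinuation` yields `g_δ(1) → Uc(1) = U(1, η)`,
which is `cardyFunction η` by `ContinuumFamily (i)`; finally `g_δ(1) = u_R(1, δ)` is the bond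
crossing probability for `δ > 0` (`BernoulliEndpoint`), and real parts give
`R.HasCrossingLimit (bondDomainCrossingProb R) cardyFunction`.

The argument is first run, for one `R`, with ABSTRACT functions `U : ℝ → ℝ → ℝ` (continuum
family) and `u : ℝ → ℝ → ℝ` (lattice family of `R`) in `cardyUST_assembly_core`; the route
statement follows by unfolding the five route definitions, whose shared `let`s (`Z`, `U`, `uJ`)
ζ-reduce to syntactically identical bodies.
-/

namespace Summit.CriticalPhenomena.CardyFormulaZ2.Theorems

open Filter Set Topology
open Literature.Probability.RandomPlanarGeometry Literature.Probability.Percolation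
open Summit.CriticalPhenomena.CardyFormulaZ2.Theses.CardyUSTContinuation

/-- **Abstract assembly, one conformal rectangle `R`.** For any continuum family `U t η` and any
lattice family `u t δ` attached to `R`: if (S) there is `t₀ > 0` such that `u t ·` has crossing
limit `U t` for all `t ∈ (0, t₀)`; (A) for every `t₁ ∈ (0,1)`, eventually in `δ → 0⁺`,
`t ↦ u t δ` on `[t₁, 1]` extends to a function analytic and bounded by one `M` on one complex
`ρ`-neighbourhood of `[t₁, 1]`; (B) `u 1 δ` is the bond crossing probability of `R` for `δ > 0`;
(C₁) `U 1 = cardyFunction` on `(0,1)`; (C₂) each `U · η` extends analytically near `[0, 1] ⊆ ℂ`;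
and (V) the route's Vitali-continuation statement holds — then `R` has crossing limit
`cardyFunction` for bond percolation on `ℤ²` at `p = 1/2`. -/
theorem cardyUST_assembly_core (U : ℝ → ℝ → ℝ) (u : ℝ → ℝ → ℝ) (R : ConformalRectangle)
    (hS : ∃ t₀ > (0:ℝ), ∀ t ∈ Set.Ioo 0 t₀, R.HasCrossingLimit (fun δ => u t δ) (U t))
    (hA : ∀ t₁ ∈ Set.Ioo (0:ℝ) 1, ∃ ρ > (0:ℝ), ∃ M : ℝ,
      ∀ᶠ δ in 𝓝[>] (0:ℝ), ∃ g : ℂ → ℂ,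
        DifferentiableOn ℂ g (Metric.thickening ρ (((↑) : ℝ → ℂ) '' Set.Icc t₁ 1)) ∧
        (∀ z ∈ Metric.thickening ρ (((↑) : ℝ → ℂ) '' Set.Icc t₁ 1), ‖g z‖ ≤ M) ∧
        ∀ t ∈ Set.Icc t₁ 1, g t = u t δ)
    (hB : ∀ δ : ℝ, 0 < δ → u 1 δ = bondDomainCrossingProb R δ)
    (hC₁ : ∀ η ∈ Set.Ioo (0:ℝ) 1, U 1 η = cardyFunction η)
    (hC₂ : ∀ η ∈ Set.Ioo (0:ℝ) 1, ∃ ρ > (0:ℝ), ∃ Uc : ℂ → ℂ,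
      DifferentiableOn ℂ Uc (Metric.thickening ρ (((↑) : ℝ → ℂ) '' Set.Icc (0:ℝ) 1)) ∧
        ∀ t ∈ Set.Icc (0:ℝ) 1, Uc t = U t η)
    (hV : VitaliContinuation) :
    R.HasCrossingLimit (bondDomainCrossingProb R) cardyFunction := by
  intro φ x hφx
  have hη01 : crossRatio x ∈ Set.Ioo (0:ℝ) 1 :=
    ConformalRectangle.crossRatio_mem_Ioo_of_isUniformizing hφx
  obtain ⟨t₀, ht₀, hSR⟩ := hS
  -- at `t = 1` the lattice family is the bond crossing probability, for every `δ > 0`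
  have hB' : (fun δ => u 1 δ) =ᶠ[𝓝[>] (0:ℝ)] bondDomainCrossingProb R := by
    filter_upwards [self_mem_nhdsWithin] with δ hδ using hB δ (Set.mem_Ioi.1 hδ)
  rw [← hC₁ _ hη01]
  rcases lt_or_ge 1 t₀ with h1 | h1
  · -- `t = 1` lies in the interval of convergence: nothing to continue
    exact (hSR 1 ⟨one_pos, h1⟩ φ x hφx).congr' hB'
  · have ht₁0 : 0 < t₀ / 2 := by positivity
    have ht₁t₀ : t₀ / 2 < t₀ := by linarith
    have ht₁1 : t₀ / 2 < 1 := by linarith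
    obtain ⟨ρ, hρ, M, hAev⟩ := hA (t₀ / 2) ⟨ht₁0, ht₁1⟩
    obtain ⟨ρ', hρ', Uc, hUc, hUcU⟩ := hC₂ _ hη01
    -- the two complex neighbourhoods and their common shrinking
    set K : Set ℂ := ((↑) : ℝ → ℂ) '' Set.Icc (t₀ / 2) 1 with hK
    set ρ₀ : ℝ := min ρ ρ' with hρ₀
    have hρ₀0 : 0 < ρ₀ := lt_min hρ hρ'
    have hsub₁ : Metric.thickening ρ₀ K ⊆ Metric.thickening ρ K :=
      Metric.thickening_mono (min_le_left _ _) _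
    have hsub₂ : Metric.thickening ρ₀ K ⊆
        Metric.thickening ρ' (((↑) : ℝ → ℂ) '' Set.Icc (0:ℝ) 1) :=
      (Metric.thickening_mono (min_le_right _ _) _).trans
        (Metric.thickening_subset_of_subset _ (Set.image_mono (Set.Icc_subset_Icc_left ht₁0.le)))
    -- choose the analytic extensions `g δ` (arbitrary where none exists)
    obtain ⟨g, hgP⟩ : ∃ g : ℝ → ℂ → ℂ, ∀ᶠ δ in 𝓝[>] (0:ℝ),
        DifferentiableOn ℂ (g δ) (Metric.thickening ρ K) ∧
        (∀ z ∈ Metric.thickening ρ K, ‖g δ z‖ ≤ M) ∧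
        ∀ t ∈ Set.Icc (t₀ / 2) 1, g δ t = u t δ :=
      ⟨fun δ => Classical.epsilon (fun g : ℂ → ℂ =>
          DifferentiableOn ℂ g (Metric.thickening ρ K) ∧
          (∀ z ∈ Metric.thickening ρ K, ‖g z‖ ≤ M) ∧
          ∀ t ∈ Set.Icc (t₀ / 2) 1, g t = u t δ),
        hAev.mono fun δ hδ => Classical.epsilon_spec hδ⟩
    -- Vitali continuation from `(t₀/2, t₀)` to `t = 1`
    have hVres : Tendsto (fun δ => g δ 1) (𝓝[>] 0) (𝓝 (Uc 1)) := by
      refine hV (t₀ / 2) t₀ ρ₀ M ht₁0 ht₁t₀ ht₁1 hρ₀0 g Uc ?_ (hUc.mono hsub₂) ?_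
      · filter_upwards [hgP] with δ hδ
        exact ⟨hδ.1.mono hsub₁, fun z hz => hδ.2.1 z (hsub₁ hz)⟩
      · intro t ht
        have htIcc : t ∈ Set.Icc (t₀ / 2) 1 := ⟨ht.1.le, ht.2.le.trans h1⟩
        have ht0 : t ∈ Set.Ioo 0 t₀ := ⟨ht₁0.trans ht.1, ht.2⟩
        have hlimC : Tendsto (fun δ => ((u t δ : ℝ) : ℂ)) (𝓝[>] 0)
            (𝓝 ((U t (crossRatio x) : ℝ) : ℂ)) :=
          (Complex.continuous_ofReal.tendsto _).comp (hSR t ht0 φ x hφx)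
        rw [hUcU t ⟨ht0.1.le, htIcc.2⟩]
        refine hlimC.congr' ?_
        filter_upwards [hgP] with δ hδ
        exact (hδ.2.2 t htIcc).symm
    -- read off the value at `t = 1` and take real parts
    have h1C : Uc 1 = ((U 1 (crossRatio x) : ℝ) : ℂ) := by
      simpa using hUcU 1 ⟨zero_le_one, le_rfl⟩
    have hg1 : (fun δ => g δ 1) =ᶠ[𝓝[>] (0:ℝ)] fun δ => ((u 1 δ : ℝ) : ℂ) := by
      filter_upwards [hgP] with δ hδ
      simpa using hδ.2.2 1 ⟨ht₁1.le, le_rfl⟩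
    have hC : Tendsto (fun δ => ((u 1 δ : ℝ) : ℂ)) (𝓝[>] 0)
        (𝓝 ((U 1 (crossRatio x) : ℝ) : ℂ)) := by
      rw [← h1C]
      exact hVres.congr' hg1
    have hR := (Complex.continuous_re.tendsto _).comp hC
    simp only [Function.comp_def, Complex.ofReal_re] at hR
    exact hR.congr' hB'

/-- **Assembly of route CardyUSTContinuation** (closes item stmt-CriticalPhenomena-6054):
`SmallFugacityLimit → UniformAnalyticExtension → BernoulliEndpoint → ContinuumFamily →
VitaliContinuation → CardyFormulaZ2`. The five route definitions unfold (their shared `let`s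
ζ-reducing to identical bodies) to the hypotheses of `cardyUST_assembly_core`, with `U` the
Miller–Werner family in joint wiring and `u = uJ R` the jointly-wired self-dual FK crossing
probability of `R`; `BernoulliEndpoint` supplies hypothesis (B) after `dif_pos`. -/
theorem assembly_proof :
    Summit.CriticalPhenomena.CardyFormulaZ2.Theses.CardyUSTContinuation.Assembly := by
  unfold Assembly
  intro hS hA hB hC hV
  unfold SmallFugacityLimit at hS
  unfold UniformAnalyticExtension at hA
  unfold BernoulliEndpoint at hB
  unfold ContinuumFamily at hC
  intro R
  refine cardyUST_assembly_core _ _ R (hS R) (hA R) ?_ hC.1 hC.2 hV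
  intro δ hδ
  simp only [dif_pos hδ]
  exact hB R δ hδ

end Summit.CriticalPhenomena.CardyFormulaZ2.Theorems
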